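import Literature.IUT.HodgeArakelov.MonoThetaProjectiveBridgeEtThProofs
import Literature.IUT.HodgeArakelov.ModelDef11Output

/-!
# [IUTchII] Prop. 1.5 (ii) at the GENUINE models: the NATURAL projective system of mono-theta environments
# of `X̲̲_K` over all `M ∈ ℕ_{≥1}` in abc-iut-L6-t1's encoding, and its transition/lifting clause
# (bridge B8, part 7; abc-iut cell, layer L6, node IUTchII:Prop1.5(ii))

S. Mochizuki, *Inter-universal Teichmüller theory II*, kurims manuscript (Dec. 2020), §1, Prop. 1.5, p. 29
l. 6–45 [claim: Mochizuki2012, status: disputed] (IUTchII §1 Prop 1.5 (ii), kurims p.29): "let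
`M^Θ_* = {… → M^Θ_{M'} → M^Θ_M → …}` be a projective system of mono-theta environments … [cf. [EtTh],
Corollary 2.19, (ii), (iii)]. … (ii) The transition morphisms of the resulting projective system of topological
groups `{… → Π_X(M^Θ_{M'}) → Π_X(M^Θ_M) → …}` [cf. the notation of Definition 1.1, (i)] are all isomorphisms.
Moreover, any isomorphism of topological groups `Π_X(M^Θ_{M'}) ⥲ Π_X(M^Θ_M)`, where `M` divides `M'`, lifts
to a morphism of mono-theta environments `M^Θ_{M'} → M^Θ_M` [cf. [EtTh], Corollary 2.18, (iv)]."; S. Mochizuki,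
*The étale theta function …*, Publ. RIMS **45** (2009), Cor. 2.19 (ii) p. 290 (PRIMS PDF p. 64): "by letting
the integer `N` vary in `E`, we obtain a natural projective system `… → 𝕄_{M'} → 𝕄_M → …` of model mono-theta
environments" [cite: MochizukiEtTh2009, Cor 2.19(ii) p.64]; Cor. 2.18 (iv) p. 287 (PDF p. 61): "the natural
map `Isom^μ(M^α, M^β) → Isom(Π^α_X, Π^β_X)` … is surjective" [cite: MochizukiEtTh2009, Cor 2.18(iv) p.61].

## What abc-iut-L6-t1 froze, and what this file constructs / proves

`MonoThetaProjective.lean` (p407497) types Prop. 1.5 over a `ModelFamily S` as the structure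
`MonoThetaProjSystem F` (members `env M`, their Def. 1.1 (i) outputs `recon M`, transitions `trans`, the maps
`transX` on `Π_X` with `transX_compat`) and (ii) as the predicate `MonoThetaProjSystem.transitionsAreIsos`
(conjunct 1: every `transX h` is a bijective open map; conjunct 2: every topological isomorphism
`Π_X(M^Θ_{M'}) ⥲ Π_X(M^Θ_M)` is induced on `Π_Y` by a continuous surjection `Π_{M^Θ_{M'}} ↠ Π_{M^Θ_M}`). Over the
interface this is a property of the free datum `transX` (census abc-iut-w4-d030 / abc-iut-w4-d038,
2026-08-25/26): nothing is provable there. abc-iut-w4-d030's `EtaleLevels.modelFamily` / `EtaleLevels.reductions`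
(`MonoThetaProjectiveBridgeEtTh.lean`, p412567) give the GENUINE `ℕ_{≥1}`-indexed model family of the Tate curve
`X̲̲_K` of an [EtTh] §1 theta setting, and abc-iut-L6-d6's bridge B8 parts 5b/6 (`ModelReconstruction`,
`ModelDef11Output`) give the Def. 1.1 (i)+(ii) output of the model at each level. THIS FILE assembles them:

* `EtaleLevels.levelFrame M` — the level-`M` `ModelFrame` of B8 part 6 (`ThetaSetting.modelFrameOfThetaEnvData`)
  read at the setting `F.setting M` of the model family (they agree on the nose, `setting_modelFamily`);
* **`EtaleLevels.naturalSystem : MonoThetaProjSystem (EtaleLevels.modelFamily …)`** — the NATURAL projective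
  system of [EtTh] Cor. 2.19 (ii): `M^Θ_M := 𝕄_M` (the mod-`M` model), `recon M :=` B8-5b
  `ModelFrame.reconstruction` (so `Π_X(𝕄_M) = Π^tp_{X̲̲}` at every level, `naturalSystem_PiX`), `trans := red_{M',M}`
  (`EtaleLevels.red`: `ζ ↦ ζ^{M'/M}` on the cyclotome, the identity on `Π^tp_{Y̲̲}`), `transX := id`
  (`transX_compat` holds definitionally: `red` is the identity on the quotient `Π^tp_{Y̲̲}`);
* `EtaleLevels.naturalSystem_isMonoThetaCompatible` — its transitions ARE morphisms of mono-theta environments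
  in abc-iut-L6-t19's repaired sense (`IsMonoThetaCompatible`, `MonoThetaProjectiveR.lean` p409904) — PROVED
  (both reference isomorphisms the identity);
* **`EtaleLevels.transitionsAreIsos_naturalSystem`** — abc-iut-L6-t1's frozen **(ii) predicate HOLDS for the
  natural system**: conjunct 1 outright (`transX = id`); conjunct 2 (lifting) from the level-`M` [EtTh] Cor.
  2.18 (iv) first half `ThetaEnvData.Cor218_iv_surjective` (named fact, FACT-policy — the same currency as
  abc-iut-w4-d030's `prop15_i'_etaleLevels`) together with the `Π^tp_{Y̲̲}`-stability of topological automorphisms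
  of `Π^tp_{X̲̲}` ([EtTh] Cor. 2.18 (i), first clause of the named fact `RigidData.Cor218_i`): given
  `γ : Π_X(𝕄_{M'}) = Π^tp_{X̲̲} ⥲ Π^tp_{X̲̲} = Π_X(𝕄_M)`, lift `γ` to `α ∈ Aut(𝕄_M)` and take `α ∘ red_{M',M}`;
  `transitionsAreIsos_naturalSystem_of_cor218_i` = the same with the stability read off `Cor218_i` by name;
* `EtaleLevels.prop15_i_naturalSystem` — combined with abc-iut-w4-d030's conditional discharge of Prop. 1.5 (i)′
  (`prop15_i'_etaleLevels`, p412881): EVERY projective system of mono-theta environments over the model family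
  of `X̲̲_K` (transitions = morphisms of mono-theta environments) is isomorphic to the NATURAL one — the printed
  form of [EtTh] Cor. 2.19 (ii) in the [IUTchII] encoding, modulo exactly d030's named inputs.

Inputs beyond abc-iut-w4-d030's (all BY NAME, the hypotheses of B8 part 6 `ModelDef11Output`): abc-iut-L2-t1's
named fact `Prop15iii` and cusp labels `CuspLabels` (inputs of L2-t8's `rigidData`), and "`(l·Δ_Θ)/Ker ≅ Ẑ`
abstractly" at each level (`hZ`; [EtTh] §1 p. 12 "`Δ_Θ (≅ Ẑ(1))`", not recorded by the L2 interface).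
Prop. 1.5 (iii) for the natural system (an inhabitant of `ThetaEnvData naturalSystem`: the limit rigidity
isomorphism from abc-iut-w4-d024's all-levels cyclotome tower + `Ẑ`-completeness, the transported cohomology via
abc-iut-w4-d014's `ContH1.coeffChange`) is NOT in this file (construction row iii.C2 of the node census).

HONEST FRAMING: a construction over the cell's own [EtTh]-side constructions and two conditional theorems modulo
NAMED [EtTh] facts; the [IUTchII] claim key `Mochizuki2012` is DISPUTED (D-0012) and nothing printed in [IUTchII]
is asserted beyond what the typed structures contain; no side is taken on [IUTchIII] Cor. 3.12; typed ≠
discharged elsewhere.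
-/

noncomputable section

namespace Literature.IUT.HodgeArakelov

open Literature.AnabelianGeometry.EtaleTheta Literature.AnabelianGeometry.SemiGraphs
open scoped Literature.AnabelianGeometry.EtaleTheta

namespace EtaleLevels

variable {p : ℕ} [Fact p.Prime] {D : Literature.AnabelianGeometry.EtaleTheta.ThetaSetting p}
  {E : D.EtaleThetaData} {l : ℕ} (C : E.DoubleUnderline l) (hC : D.Compat) (hS : D.Sec2Hyps)
  (hl : l.Prime) (hp2 : p ≠ 2) (hpl : p ≠ l) (hζ : ∃ ζ : D.K, IsPrimitiveRoot ζ (4 * l))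
  (mods : ∀ M : ℕ+, D.CyclotomeMod l M)
  (f : contCocycles D.toTheta D.DeltaTheta C.GtpYdduu) (hf : f ∈ C.rootCocycles hC)
  (hmods : ∀ (M M' : ℕ+) (h : (M : ℕ) ∣ (M' : ℕ)) (x : D.lDeltaTheta l),
    MuN.red p M M' h ((mods M').red x) = (mods M).red x)
  (h15 : Literature.AnabelianGeometry.EtaleTheta.ThetaSetting.Prop15iii E hC) (L : C.CuspLabels)
  (hZ : ∀ M : ℕ+, Nonempty (ModelCyclotomes.lDeltaQuot (C.rigidData (mods M) hC hS h15 L) ≃*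
    Literature.IUT.HodgeTheaters.ZHat))

/-! ## The level-`M` frame of the model family -/

/-- The level-`M` **frame** of bridge B8 part 6 (`ThetaSetting.modelFrameOfThetaEnvData` over L2-t8's REAL
rigidity data `C.rigidData (mods M) …`, with `Π^tp_{X̲̲}` T₁ and `Δ` closed PROVED there), read at the setting
`F.setting M` of abc-iut-w4-d030's model family — the two settings agree on the nose (`setting_modelFamily`).
[claim: Mochizuki2012, status: disputed] (IUTchII §1 Def 1.1 (i), kurims pp.20-21) -/
def levelFrame (M : ℕ+) :
    ModelFrame ((modelFamily C hC hS hl hp2 hpl hζ mods f hf).setting M) (C.rigidData (mods M) hC hS h15 L) :=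
  ThetaSetting.modelFrameOfThetaEnvData (C.rigidData (mods M) hC hS h15 L)
    (ThetaSetting.SideData.ofDoubleUnderline C (mods M) hC hS hl hp2 hpl hζ (eta0_mem C hC hS mods f hf M))
    (ThetaSetting.t1Space_Huu C) (ThetaSetting.isClosed_ker_aug_thetaEnvData C (mods M) hC hS) (hZ M)

/-! ## The natural projective system -/

/-- **The NATURAL projective system of mono-theta environments of `X̲̲_K` over all `M ∈ ℕ_{≥1}`** ([EtTh] Cor.
2.19 (ii) "`… → 𝕄_{M'} → 𝕄_M → …`", in abc-iut-L6-t1's [IUTchII] Prop. 1.5 encoding): `M^Θ_M :=` the mod-`M` model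
`𝕄_M` of the family; its Def. 1.1 (i) output `:=` bridge B8's `ModelFrame.reconstruction` (whence
`Π_Y(𝕄_M) = Π^tp_{Y̲̲}`, `Π_X(𝕄_M) = Π^tp_{X̲̲}`, `G(𝕄_M) = Π^tp_{X̲̲}/Δ` at EVERY level); transitions `:= red_{M',M}`;
the transition on `Π_X` `:=` the identity of `Π^tp_{X̲̲}` (compatible with `Π ↠ Π_Y ⊆ Π_X` because `red_{M',M}` is the
identity on `Π^tp_{Y̲̲}`). [claim: Mochizuki2012, status: disputed] (IUTchII §1 Prop 1.5, kurims p.29)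
[cite: MochizukiEtTh2009, Cor 2.19(ii) p.64] -/
def naturalSystem : MonoThetaProjSystem (modelFamily C hC hS hl hp2 hpl hζ mods f hf) where
  env M := (modelFamily C hC hS hl hp2 hpl hζ mods f hf).modelEnv M
  recon M := (levelFrame C hC hS hl hp2 hpl hζ mods f hf h15 L hZ M).reconstruction (ContinuousMulEquiv.refl _)
  trans h := red C hC hS mods h
  trans_continuous h := continuous_red C hC hS mods hmods h
  trans_refl M x := red_refl C hC hS mods M x
  trans_comp h h' x := red_comp C hC hS mods h h' x
  transX _ := MonoidHom.id _
  transX_continuous _ := continuous_id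
  transX_compat _ _ := rfl

/-- `Π_X(M^Θ_*) = Π^tp_{X̲̲}` for the natural system (Prop. 1.5 (ii): "we shall identify these topological groups
via these transition morphisms and denote the resulting topological group by `Π_X(M^Θ_*)`" — here the
identifications are identities). [claim: Mochizuki2012, status: disputed] (IUTchII §1 Prop 1.5 (ii), kurims p.29) -/
theorem naturalSystem_PiX :
    (naturalSystem C hC hS hl hp2 hpl hζ mods f hf hmods h15 L hZ).PiX = TopGroup.of ↥C.Huu :=
  rfl

/-- The transitions of the natural system are the model reductions `red_{M',M}` (bookkeeping).
[cite: MochizukiEtTh2009, Def 2.13(ii) p.48] -/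
theorem naturalSystem_trans {M M' : ℕ+} (h : (M : ℕ) ∣ (M' : ℕ))
    (x : (levelData C hC hS mods M').env) :
    (naturalSystem C hC hS hl hp2 hpl hζ mods f hf hmods h15 L hZ).trans h x = red C hC hS mods h x :=
  rfl

/-- The transitions of the natural system on `Π_X` are identities (bookkeeping).
[claim: Mochizuki2012, status: disputed] (IUTchII §1 Prop 1.5 (ii), kurims p.29) -/
theorem naturalSystem_transX {M M' : ℕ+} (h : (M : ℕ) ∣ (M' : ℕ)) (x : ↥C.Huu) :
    (naturalSystem C hC hS hl hp2 hpl hζ mods f hf hmods h15 L hZ).transX h x = x :=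
  rfl

/-! ## The natural system is a system OF MONO-THETA ENVIRONMENTS (abc-iut-L6-t19's repaired sense) -/

/-- **The transitions of the natural system are morphisms of mono-theta environments** ([EtTh] Def. 2.13 (ii)):
`naturalSystem` is `IsMonoThetaCompatible` with the model reductions of abc-iut-w4-d030 — both reference
isomorphisms `M^Θ_M ⥲ 𝕄_M` are identities and `trans = red`. PROVED.
[claim: Mochizuki2012, status: disputed] (IUTchII §1 Prop 1.5, kurims p.29) [cite: MochizukiEtTh2009, Def 2.13(ii) p.48] -/
theorem naturalSystem_isMonoThetaCompatible
    (hslimX : Literature.AlgebraicGeometry.Frobenioids.IsSlimGroup D.PiTemp) :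
    (naturalSystem C hC hS hl hp2 hpl hζ mods f hf hmods h15 L hZ).IsMonoThetaCompatible
      (reductions C hC hS hl hp2 hpl hζ mods f hf hmods hslimX) := by
  intro M M' h
  exact ⟨MonoThetaEnv.Iso.refl _, MonoThetaEnv.Iso.refl _, fun x => rfl⟩

/-! ## Prop. 1.5 (ii) for the natural system -/

include hmods in
/-- **[IUTchII] Prop. 1.5 (ii) HOLDS for the natural projective system of `X̲̲_K`** — abc-iut-L6-t1's frozen
predicate `MonoThetaProjSystem.transitionsAreIsos`: (1) "the transition morphisms `Π_X(M^Θ_{M'}) → Π_X(M^Θ_M)`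
are all isomorphisms" — here identities of `Π^tp_{X̲̲}`; (2) "any isomorphism of topological groups
`Π_X(M^Θ_{M'}) ⥲ Π_X(M^Θ_M)`, where `M` divides `M'`, lifts to a morphism of mono-theta environments
`M^Θ_{M'} → M^Θ_M` [cf. [EtTh], Corollary 2.18, (iv)]" — given such `γ` (a topological automorphism of
`Π^tp_{X̲̲}`), `γ` preserves `Π^tp_{Y̲̲}` (hypothesis `hY`, [EtTh] Cor. 2.18 (i)), hence lifts to an automorphism `α`
of the mod-`M` model by the level-`M` named fact `ThetaEnvData.Cor218_iv_surjective` ([EtTh] Cor. 2.18 (iv),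
first half), and `α ∘ red_{M',M} : Π_{𝕄_{M'}} ↠ Π_{𝕄_M}` is continuous, surjective and induces `γ` on `Π^tp_{Y̲̲}`.
CONDITIONAL on the two named [EtTh] inputs (FACT-policy; the same currency as `prop15_i'_etaleLevels`).
[claim: Mochizuki2012, status: disputed] (IUTchII §1 Prop 1.5 (ii), kurims p.29) [cite: MochizukiEtTh2009, Cor 2.18(iv) p.61] -/
theorem transitionsAreIsos_naturalSystem
    (hsurj : ∀ M : ℕ+, (levelData C hC hS mods M).Cor218_iv_surjective)
    (hY : ∀ (M : ℕ+) (γ : (levelData C hC hS mods M).PiX ≃ₜ* (levelData C hC hS mods M).PiX),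
      (levelData C hC hS mods M).PiY.map γ.toMulEquiv.toMonoidHom = (levelData C hC hS mods M).PiY) :
    (naturalSystem C hC hS hl hp2 hpl hζ mods f hf hmods h15 L hZ).transitionsAreIsos := by
  refine ⟨fun h => ⟨Function.bijective_id, IsOpenMap.id⟩, fun {M M'} h γ => ?_⟩
  obtain ⟨α, hα⟩ := hsurj M (eta0 C hC mods f hf M) (eta0_mem C hC hS mods f hf M) γ (hY M γ)
  refine ⟨α.e.toMonoidHom.comp (red C hC hS mods h), α.e.continuous.comp (continuous_red C hC hS mods hmods h),
    α.e.surjective.comp (red_surjective C hC hS mods hmods h), fun x => ?_⟩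
  change γ ((CycEnvelope.proj (levelData C hC hS mods M').augY (levelData C hC hS mods M').chi x :
      (levelData C hC hS mods M').PiY) : C.Huu) =
    ((CycEnvelope.proj (levelData C hC hS mods M).augY (levelData C hC hS mods M).chi
      (α.e (red C hC hS mods h x)) : (levelData C hC hS mods M).PiY) : C.Huu)
  rw [hα (red C hC hS mods h x)]
  rfl

include hmods in
/-- `transitionsAreIsos_naturalSystem` with the `Π^tp_{Y̲̲}`-stability read off the named fact **[EtTh] Cor. 2.18
(i)** (`RigidData.Cor218_i`, first clause: every topological automorphism of `Π^tp_{X̲̲}` carries `Π^tp_{Y̲̲}` onto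
itself) for L2-t8's rigidity data of `X̲̲_K` at any one level. [claim: Mochizuki2012, status: disputed] (IUTchII §1 Prop 1.5 (ii), kurims p.29)
[cite: MochizukiEtTh2009, Cor 2.18(i) p.60] -/
theorem transitionsAreIsos_naturalSystem_of_cor218_i
    (hsurj : ∀ M : ℕ+, (levelData C hC hS mods M).Cor218_iv_surjective)
    (h218i : (C.rigidData (mods 1) hC hS h15 L).Cor218_i) :
    (naturalSystem C hC hS hl hp2 hpl hζ mods f hf hmods h15 L hZ).transitionsAreIsos :=
  transitionsAreIsos_naturalSystem C hC hS hl hp2 hpl hζ mods f hf hmods h15 L hZ hsurj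
    fun _ γ => (h218i γ).1

/-! ## [EtTh] Cor. 2.19 (ii) in the [IUTchII] encoding: every system is isomorphic to the natural one -/

include hmods in
/-- **Every projective system of mono-theta environments over the model family of `X̲̲_K` is isomorphic to the
NATURAL one** ([EtTh] Cor. 2.19 (ii) as printed: "any projective system `… → M•_{M'} → M•_M → …` … is isomorphic
to the above natural projective system", here over ALL of `ℕ_{≥1}` and in abc-iut-L6-t1's `Prop15_i` form: a
compatible family of isomorphisms of mono-theta environments) — for systems whose transitions are morphisms of
mono-theta environments (`IsMonoThetaCompatible`), from abc-iut-w4-d030's conditional discharge of [IUTchII] Prop.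
1.5 (i)′ (`prop15_i'_etaleLevels`, p412881) applied to `(naturalSystem, B)`. CONDITIONAL on exactly d030's
named inputs (temp-slimness `IsSlimGroup D.PiTemp`, `IsOpenMap D.aug`, and at every level the [EtTh] Cor. 2.18
(iv) facts `Cor218_iv_surjective`, `Cor218_iv_fibre`). [claim: Mochizuki2012, status: disputed] (IUTchII §1 Prop 1.5 (i), kurims p.29)
[cite: MochizukiEtTh2009, Cor 2.19(ii) p.64] -/
theorem prop15_i_naturalSystem (hslimX : Literature.AlgebraicGeometry.Frobenioids.IsSlimGroup D.PiTemp)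
    (haugOpen : IsOpenMap D.aug)
    (hsurj : ∀ M : ℕ+, (levelData C hC hS mods M).Cor218_iv_surjective)
    (hfibre : ∀ M : ℕ+, (levelData C hC hS mods M).Cor218_iv_fibre)
    (B : MonoThetaProjSystem (modelFamily C hC hS hl hp2 hpl hζ mods f hf))
    (hB : B.IsMonoThetaCompatible (reductions C hC hS hl hp2 hpl hζ mods f hf hmods hslimX)) :
    Prop15_i (naturalSystem C hC hS hl hp2 hpl hζ mods f hf hmods h15 L hZ) B :=
  prop15_i'_etaleLevels C hC hS hl hp2 hpl hζ mods f hf hmods hslimX haugOpen hsurj hfibre _ B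
    (naturalSystem_isMonoThetaCompatible C hC hS hl hp2 hpl hζ mods f hf hmods h15 L hZ hslimX) hB

end EtaleLevels

end Literature.IUT.HodgeArakelov
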